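import Literature.Combinatorics.LorentzianPolynomials.LorentzianClosed
import HarnessLib

/-!
# Strictly Lorentzian quadratic forms: Brändén–Huh Lemma 2.5, and the second description of `L̊^d_n`

Layer `Literature/Combinatorics/LorentzianPolynomials`, namespace `Literature.Combinatorics.LorentzianPolynomials`;
lane `lit-hodgefound` (Track 2 foundations library), seat p16, generation 29 (row g29-#7). The tree has Brändén–Huh's
Lemma 2.5 in its CLOSED form (`L²_n` = stable quadratics = "at most one positive eigenvalue":
`StableQuadratic.mem_lorentzian_two_iff_forall_mul_le_sq`, the reverse Cauchy–Schwarz inequality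
`LorentzianReverseSchwarz.mul_le_sq_of_sigPos_le_one`) and Definition 2.1 (`LorentzianClosed.strictlyLorentzian`). This
file proves Lemma 2.5 AS PRINTED — for the OPEN class `L̊²_n` (nonsingular Hessian with exactly one positive
eigenvalue) and the STRICT reverse Cauchy–Schwarz inequality `(uᵀ𝓗v)² > (uᵀ𝓗u)(vᵀ𝓗v)` — together with its analytic
reading "`f(xu - v)` has two distinct real zeros" (a negative value on the line), and the second description
`L̊^d_n = {f ∈ P^d_n | ∂^α f ∈ L̊²_n for all α ∈ Δ^{d-2}_n}` of Definition 2.1. These are the tools of the Nuij-type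
homotopy (Lemma 2.12, Theorem 2.13).

## Source (verbatim) — P. Brändén, J. Huh, *Lorentzian polynomials* [BrandenHuh2019] (held `paper:arxiv-1902.03719`)

§2.1 (pp. 8–10): "Let `P^d_n ⊆ H^d_n` be the open subset of polynomials all of whose coefficients are positive."
**Definition 2.1** "… `L̊²_n = {f ∈ P²_n | 𝓗_f is nonsingular and has exactly one positive eigenvalue}`. For `d` larger
than `2`, we define `L̊^d_n` recursively by setting `L̊^d_n = {f ∈ P^d_n | ∂_i f ∈ L̊^{d-1}_n for all i ∈ [n]}` … Thus
`L̊^d_n = {f ∈ P^d_n | ∂^α f ∈ L̊²_n for every α ∈ Δ^{d-2}_n}`." **Lemma 2.5.** "The following conditions are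
equivalent for any `f ∈ P²_n`. (1) The Hessian of `f` has the Lorentzian signature `(+, -, …, -)`, that is,
`f ∈ L̊²_n`. (2) For any nonzero `u ∈ ℝ^n_{≥0}`, `(uᵀ𝓗_f v)² > (uᵀ𝓗_f u)(vᵀ𝓗_f v)` for any `v ∈ ℝ^n` not parallel
to `u`. (3) For some `u ∈ ℝ^n_{≥0}`, `(uᵀ𝓗_f v)² > (uᵀ𝓗_f u)(vᵀ𝓗_f v)` for any `v ∈ ℝ^n` not parallel to `u`.
(4) For any nonzero `u ∈ ℝ^n_{≥0}`, the univariate polynomial `f(xu - v)` in `x` has two distinct real zeros for any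
`v ∈ ℝ^n` not parallel to `u`. (5) For some `u ∈ ℝ^n_{≥0}`, the univariate polynomial `f(xu - v)` in `x` has two
distinct real zeros for any `v ∈ ℝ^n` not parallel to `u`. […] *Proof.* We prove (1) ⟹ (2). Since all the entries of
`𝓗_f` are positive, `uᵀ𝓗_f u > 0` for any nonzero `u ∈ ℝ^n_{≥0}`. By Cauchy's interlacing theorem, for any `v ∈ ℝ^n`
not parallel to `u`, the restriction of `𝓗_f` to the plane spanned by `u, v` has signature `(+, -)`. It follows that
`(uᵀ𝓗_f u)(vᵀ𝓗_f v) - (uᵀ𝓗_f v)² < 0`. We prove (3) ⟹ (1). Let `u` be the nonnegative vector in the statement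
(3). Then `𝓗_f` is negative definite on the hyperplane `{v ∈ ℝ^n | uᵀ𝓗_f v = 0}`. Since `f ∈ P²_n`, we have
`uᵀ𝓗_f u > 0`, and hence `𝓗_f` has the Lorentzian signature. The remaining implications follows from the fact that
the univariate polynomial `½ f(xu - v)` has the discriminant `(uᵀ𝓗_f v)² - (uᵀ𝓗_f u)(vᵀ𝓗_f v)`."

## What is here

* §1 `P²_n`: positivity of the Hessian entries and of `uᵀ𝓗u` for nonzero `u ≥ 0`.
* §2 nonsingularity of `𝓗` as nondegeneracy of the form `wᵀ𝓗w'`; `sigNeg = n - 1` on `L̊²_n`.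
* §3 **Lemma 2.5**: (1) ⟹ (2) `mul_lt_sq_of_mem_strictlyLorentzian_two`, (3) ⟹ (1)
  `mem_strictlyLorentzian_two_of_mul_lt_sq`, the equivalences, and (4)/(5) in the form actually used in the proof of
  Lemma 2.12 — a negative value of `f` on the line `xu - v` (`exists_eval_smul_sub_neg_iff_mul_lt_sq`) — and as printed,
  two distinct real zeros of `f(xu - v)` (`mem_strictlyLorentzian_two_iff_forall_exists_ne_eval_eq_zero`).
* §4 the second description of `L̊^d_n` (`mem_strictlyLorentzian_iff_forall_iterPderiv`), with
  `iterPderiv_mem_strictlyLorentzian`.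

Theorems only (no new definitions, no named facts; net debt 0).

## References

* [BrandenHuh2019] P. Brändén, J. Huh, *Lorentzian polynomials*, Ann. of Math. (2) 192 (2020) 821–891, arXiv:1902.03719 —
  §2.1 Def. 2.1, Lemma 2.5 (pp. 8–10).
* [Serre1973] J.-P. Serre, *A course in arithmetic*, GTM 7, Ch. V §1.3.2 (Sylvester's law of inertia).
-/

noncomputable section

open MvPolynomial Finsupp Finset Module
open Literature.LinearAlgebra.QuadraticForm

namespace Literature.Combinatorics.LorentzianPolynomials

variable {σ : Type*} [Fintype σ] [DecidableEq σ]

/-! ## §1 `P²_n`: positive Hessian entries -/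

section Positive

omit [DecidableEq σ] in
/-- For `f ∈ P²_n` every Hessian entry `𝓗_{ab} = c_{e_a+e_b}(f)` is positive ("Since all the entries of `𝓗_f` are
positive"). [cite: BrandenHuh2019, §2.1 Lemma 2.5 (proof of (1) ⟹ (2))] -/
theorem hessian_apply_pos_of_forall_coeff_pos {q : MvPolynomial σ ℝ}
    (hpos : ∀ α : σ →₀ ℕ, α.degree = 2 → 0 < coeff α q) (a b : σ) : 0 < hessian q a b := by
  rw [hessian_apply_eq_normCoeff, normCoeff_pos_iff]
  exact hpos _ (by rw [map_add, degree_single, degree_single])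

/-- A symmetric-matrix computation: if all entries of `H` are nonnegative, `H_{kk} > 0`, `u ≥ 0` and `u_k > 0`, then
`uᵀHu > 0` ("`uᵀ𝓗_f u > 0` for any nonzero `u ∈ ℝ^n_{≥0}`"). [cite: BrandenHuh2019, §2.1 Lemma 2.5 (proof of (1) ⟹
(2))] -/
theorem toBilin'_self_pos_of_nonneg {H : Matrix σ σ ℝ} (hH : ∀ a b, 0 ≤ H a b) {k : σ} (hk : 0 < H k k) {u : σ → ℝ}
    (hu : ∀ a, 0 ≤ u a) (huk : 0 < u k) : 0 < Matrix.toBilin' H u u := by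
  rw [Matrix.toBilin'_apply]
  have h1 : u k * H k k * u k ≤ ∑ b, u k * H k b * u b :=
    Finset.single_le_sum (f := fun b ↦ u k * H k b * u b)
      (fun b _ ↦ mul_nonneg (mul_nonneg (hu k) (hH k b)) (hu b)) (Finset.mem_univ k)
  have h2 : ∑ b, u k * H k b * u b ≤ ∑ a, ∑ b, u a * H a b * u b :=
    Finset.single_le_sum (f := fun a ↦ ∑ b, u a * H a b * u b)
      (fun a _ ↦ Finset.sum_nonneg fun b _ ↦ mul_nonneg (mul_nonneg (hu a) (hH a b)) (hu b)) (Finset.mem_univ k)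
  have h0 : 0 < u k * H k k * u k := mul_pos (mul_pos huk hk) huk
  linarith

omit [DecidableEq σ] in
/-- "Since `f ∈ P²_n`, we have `uᵀ𝓗_f u > 0`" for every nonzero `u ∈ ℝ^n_{≥0}`. [cite: BrandenHuh2019, §2.1 Lemma 2.5
(proofs of (1) ⟹ (2) and (3) ⟹ (1))] -/
theorem toBilin'_hessian_self_pos_of_forall_coeff_pos [DecidableEq σ] {q : MvPolynomial σ ℝ}
    (hpos : ∀ α : σ →₀ ℕ, α.degree = 2 → 0 < coeff α q) {u : σ → ℝ} (hu : ∀ a, 0 ≤ u a) (hu0 : u ≠ 0) :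
    0 < Matrix.toBilin' (hessian q) u u := by
  obtain ⟨k, hk⟩ := Function.ne_iff.1 hu0
  exact toBilin'_self_pos_of_nonneg (fun a b ↦ (hessian_apply_pos_of_forall_coeff_pos hpos a b).le)
    (hessian_apply_pos_of_forall_coeff_pos hpos k k) hu (lt_of_le_of_ne (hu k) (Ne.symm hk))

/-- `e_kᵀ 𝓗_f e_k = 𝓗_{kk} > 0` for `f ∈ P²_n`. [cite: BrandenHuh2019, §2.1 Lemma 2.5 (proof of (1) ⟹ (2))] -/
theorem toBilin'_hessian_single_single_pos {q : MvPolynomial σ ℝ}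
    (hpos : ∀ α : σ →₀ ℕ, α.degree = 2 → 0 < coeff α q) (k : σ) :
    0 < Matrix.toBilin' (hessian q) (Pi.single k 1) (Pi.single k 1) := by
  rw [Matrix.toBilin'_single]
  exact hessian_apply_pos_of_forall_coeff_pos hpos k k

end Positive

/-! ## §2 Nonsingular Hessians -/

section Nonsingular

/-- `det H ≠ 0` makes the form `(w, w') ↦ wᵀHw'` nondegenerate. [cite: BrandenHuh2019, §2.1 Def. 2.1 ("`𝓗_f` is
nonsingular")] [cite: Serre1973, Ch. V §1.3.2] -/
theorem eq_zero_of_forall_toBilin'_eq_zero {H : Matrix σ σ ℝ} (hdet : H.det ≠ 0) {x : σ → ℝ}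
    (hx : ∀ y, Matrix.toBilin' H y x = 0) : x = 0 := by
  by_contra hx0
  refine hdet (Matrix.exists_mulVec_eq_zero_iff.1 ⟨x, hx0, ?_⟩)
  ext k
  have h := hx (Pi.single k 1)
  rwa [Matrix.toBilin'_apply', single_dotProduct, one_mul] at h

/-- Conversely, a nondegenerate symmetric `wᵀHw'` has `det H ≠ 0`. [cite: BrandenHuh2019, §2.1 Def. 2.1 ("`𝓗_f` is
nonsingular")] [cite: Serre1973, Ch. V §1.3.2] -/
theorem det_ne_zero_of_forall_toBilin'_eq_zero {H : Matrix σ σ ℝ}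
    (h : ∀ x : σ → ℝ, (∀ y, Matrix.toBilin' H y x = 0) → x = 0) : H.det ≠ 0 := by
  intro hdet
  obtain ⟨z, hz0, hz⟩ := Matrix.exists_mulVec_eq_zero_iff.2 hdet
  exact hz0 (h z fun y ↦ by rw [Matrix.toBilin'_apply', hz, dotProduct_zero])

/-- On `L̊²_n` the form `wᵀ𝓗w'` is nondegenerate, so `sigPos + sigNeg = n` (Sylvester) and **`sigNeg = n - 1`**: the
Lorentzian signature `(+, -, …, -)`. [cite: BrandenHuh2019, §2.1 Def. 2.1 and Lemma 2.5 (1) ("the Lorentzian signature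
`(+, -, …, -)`")] [cite: Serre1973, Ch. V §1.3.2] -/
theorem sigPos_add_sigNeg_of_mem_strictlyLorentzian_two {q : MvPolynomial σ ℝ} (hq : q ∈ strictlyLorentzian σ 2) :
    sigPos (Matrix.toBilin' (hessian q)).toQuadraticMap = 1 ∧
      sigNeg (Matrix.toBilin' (hessian q)).toQuadraticMap = Fintype.card σ - 1 := by
  obtain ⟨-, -, hdet, hsig⟩ := mem_strictlyLorentzian_two.1 hq
  have hsum := LinearMap.BilinForm.sigPos_add_sigNeg_eq_finrank_of_isSymm (Matrix.toBilin' (hessian q))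
    (LinearMap.BilinForm.isSymm_iff.2 (isSymm_toBilin'_of_isSymm (isSymm_hessian q)))
    (fun x hx ↦ eq_zero_of_forall_toBilin'_eq_zero hdet fun y ↦ by
      rw [toBilin'_hessian_comm q x y]; exact hx y)
  rw [finrank_fintype_fun_eq_card, hsig] at hsum
  exact ⟨hsig, by omega⟩

/-- On `L̊²_n`: `n ≤ sigNeg + 1` (the hypothesis shape of `LorentzianReverseSchwarz.mul_lt_sq_of_forall_ne_smul`).
[cite: BrandenHuh2019, §2.1 Lemma 2.5 (1)] -/
theorem finrank_le_sigNeg_add_one_of_mem_strictlyLorentzian_two {q : MvPolynomial σ ℝ}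
    (hq : q ∈ strictlyLorentzian σ 2) :
    finrank ℝ (σ → ℝ) ≤ sigNeg (Matrix.toBilin' (hessian q)).toQuadraticMap + 1 := by
  rw [finrank_fintype_fun_eq_card, (sigPos_add_sigNeg_of_mem_strictlyLorentzian_two hq).2]
  omega

end Nonsingular

/-! ## §3 Lemma 2.5 -/

section Lemma25

/-- **Lemma 2.5, (1) ⟹ (2)/(3): on `L̊²_n` the reverse Cauchy–Schwarz inequality is STRICT** —
`(vᵀ𝓗v)(uᵀ𝓗u) < (vᵀ𝓗u)²` whenever `uᵀ𝓗u > 0` (e.g. `u ≥ 0` nonzero) and `v` is not parallel to `u` ("the restriction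
of `𝓗_f` to the plane spanned by `u, v` has signature `(+, -)`"). [cite: BrandenHuh2019, §2.1 Lemma 2.5 (1) ⟹ (2)] -/
theorem mul_lt_sq_of_mem_strictlyLorentzian_two {q : MvPolynomial σ ℝ} (hq : q ∈ strictlyLorentzian σ 2)
    {u v : σ → ℝ} (hu : 0 < Matrix.toBilin' (hessian q) u u) (hv : ∀ t : ℝ, v ≠ t • u) :
    Matrix.toBilin' (hessian q) v v * Matrix.toBilin' (hessian q) u u < Matrix.toBilin' (hessian q) v u ^ 2 :=
  mul_lt_sq_of_forall_ne_smul _ (isSymm_toBilin'_of_isSymm (isSymm_hessian q))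
    (finrank_le_sigNeg_add_one_of_mem_strictlyLorentzian_two hq) hu hv

/-- **Lemma 2.5, (1) ⟹ (2) as printed**: for `f ∈ L̊²_n`, any nonzero `u ∈ ℝ^n_{≥0}` and any `v` not parallel to `u`,
`(uᵀ𝓗_f v)² > (uᵀ𝓗_f u)(vᵀ𝓗_f v)`. [cite: BrandenHuh2019, §2.1 Lemma 2.5 (1) ⟹ (2)] -/
theorem mul_lt_sq_of_mem_strictlyLorentzian_two_of_nonneg {q : MvPolynomial σ ℝ} (hq : q ∈ strictlyLorentzian σ 2)
    {u v : σ → ℝ} (hu : ∀ a, 0 ≤ u a) (hu0 : u ≠ 0) (hv : ∀ t : ℝ, v ≠ t • u) :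
    Matrix.toBilin' (hessian q) u u * Matrix.toBilin' (hessian q) v v < Matrix.toBilin' (hessian q) u v ^ 2 := by
  have h := mul_lt_sq_of_mem_strictlyLorentzian_two hq
    (toBilin'_hessian_self_pos_of_forall_coeff_pos (mem_strictlyLorentzian_two.1 hq).2.1 hu hu0) hv
  rwa [mul_comm, toBilin'_hessian_comm q u v] at h

/-- **Lemma 2.5, (3) ⟹ (1)**: if `f ∈ P²_n` and, for SOME `u` with `uᵀ𝓗u > 0`, `(vᵀ𝓗v)(uᵀ𝓗u) < (vᵀ𝓗u)²` for every `v`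
not parallel to `u`, then `f ∈ L̊²_n` ("`𝓗_f` is negative definite on the hyperplane `{v | uᵀ𝓗_f v = 0}` … and hence
`𝓗_f` has the Lorentzian signature"; nonsingularity: a kernel vector `z` would have `zᵀ𝓗u = zᵀ𝓗z = 0`).
[cite: BrandenHuh2019, §2.1 Lemma 2.5 (3) ⟹ (1)] -/
theorem mem_strictlyLorentzian_two_of_mul_lt_sq {q : MvPolynomial σ ℝ} (hq : q.IsHomogeneous 2)
    (hpos : ∀ α : σ →₀ ℕ, α.degree = 2 → 0 < coeff α q) {u : σ → ℝ} (hu : 0 < Matrix.toBilin' (hessian q) u u)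
    (h : ∀ v : σ → ℝ, (∀ t : ℝ, v ≠ t • u) →
      Matrix.toBilin' (hessian q) v v * Matrix.toBilin' (hessian q) u u < Matrix.toBilin' (hessian q) v u ^ 2) :
    q ∈ strictlyLorentzian σ 2 := by
  set B := Matrix.toBilin' (hessian q) with hB
  -- on the hyperplane `u^⊥` the form is negative definite
  have hneg : ∀ z, B z u = 0 → z ≠ 0 → B z z < 0 := by
    intro z hzu hz0
    by_cases hpar : ∃ t : ℝ, z = t • u
    · obtain ⟨t, rfl⟩ := hpar
      have ht : t = 0 := by
        rw [map_smul, LinearMap.smul_apply, smul_eq_mul] at hzu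
        exact (mul_eq_zero.1 hzu).resolve_right hu.ne'
      exact absurd (by rw [ht, zero_smul]) hz0
    · push Not at hpar
      have hlt := h z hpar
      rw [hzu, sq, mul_zero] at hlt
      exact neg_of_mul_neg_left hlt hu.le
  refine mem_strictlyLorentzian_two.2 ⟨hq, hpos, ?_, ?_⟩
  · refine det_ne_zero_of_forall_toBilin'_eq_zero fun z hz ↦ ?_
    by_contra hz0
    have hzu : B z u = 0 := by rw [hB, toBilin'_hessian_comm q u z]; exact hz u
    have hzz : B z z = 0 := hz z
    exact (hneg z hzu hz0).ne hzz
  · exact sigPos_eq_one_of_orthogonal_nonpos B hu fun z hz ↦ by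
      rcases eq_or_ne z 0 with rfl | hz0
      · simp
      · exact (hneg z hz hz0).le

/-- **Lemma 2.5, (1) ⟺ (3)** with the witness `u` any vector of positive square (e.g. a nonzero `u ∈ ℝ^n_{≥0}`).
[cite: BrandenHuh2019, §2.1 Lemma 2.5 ((1) ⟺ (2) ⟺ (3))] -/
theorem mem_strictlyLorentzian_two_iff_forall_mul_lt_sq {q : MvPolynomial σ ℝ} (hq : q.IsHomogeneous 2)
    (hpos : ∀ α : σ →₀ ℕ, α.degree = 2 → 0 < coeff α q) {u : σ → ℝ} (hu : 0 < Matrix.toBilin' (hessian q) u u) :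
    q ∈ strictlyLorentzian σ 2 ↔ ∀ v : σ → ℝ, (∀ t : ℝ, v ≠ t • u) →
      Matrix.toBilin' (hessian q) v v * Matrix.toBilin' (hessian q) u u < Matrix.toBilin' (hessian q) v u ^ 2 :=
  ⟨fun h _ hv ↦ mul_lt_sq_of_mem_strictlyLorentzian_two h hu hv, mem_strictlyLorentzian_two_of_mul_lt_sq hq hpos hu⟩

/-- **The line `xu - v` through a symmetric form**: `B(xu - v, xu - v) = x² B(u,u) - 2x B(u,v) + B(v,v)`.
[cite: BrandenHuh2019, §2.1 Lemma 2.5 (last paragraph of the proof: the discriminant of `½ f(xu - v)`)] -/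
theorem toBilin'_smul_sub_self {H : Matrix σ σ ℝ} (hH : H.IsSymm) (x : ℝ) (u v : σ → ℝ) :
    Matrix.toBilin' H (x • u - v) (x • u - v) =
      x ^ 2 * Matrix.toBilin' H u u - 2 * x * Matrix.toBilin' H u v + Matrix.toBilin' H v v := by
  have hc : Matrix.toBilin' H v u = Matrix.toBilin' H u v := symm_apply (isSymm_toBilin'_of_isSymm hH) v u
  simp only [map_sub, map_smul, LinearMap.sub_apply, LinearMap.smul_apply, smul_eq_mul, hc]
  ring

/-- **A negative value on the line forces the strict inequality**: if `B(u,u) > 0` and `B(xu - v, xu - v) < 0` for some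
`x`, then `B(v,v) B(u,u) < B(v,u)²` (completing the square: `B(u,u) · B(w,w) = (x B(u,u) - B(u,v))² - (B(u,v)² -
B(u,u)B(v,v))`). [cite: BrandenHuh2019, §2.1 Lemma 2.5 ((4)/(5) ⟹ (2)/(3)); §2.3 proof of Lemma 2.12 ("and hence
`∂^α g` has two distinct real zeros")] -/
theorem mul_lt_sq_of_toBilin'_smul_sub_self_neg {H : Matrix σ σ ℝ} (hH : H.IsSymm) {u v : σ → ℝ}
    (hu : 0 < Matrix.toBilin' H u u) {x : ℝ} (hx : Matrix.toBilin' H (x • u - v) (x • u - v) < 0) :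
    Matrix.toBilin' H v v * Matrix.toBilin' H u u < Matrix.toBilin' H v u ^ 2 := by
  rw [toBilin'_smul_sub_self hH] at hx
  rw [symm_apply (isSymm_toBilin'_of_isSymm hH) v u]
  nlinarith [sq_nonneg (x * Matrix.toBilin' H u u - Matrix.toBilin' H u v)]

/-- **Conversely the strict inequality produces a negative value on the line**, at the critical point
`x = B(u,v)/B(u,u)` (where `B(u, xu - v) = 0`): `B(w,w) = B(v,v) - B(u,v)²/B(u,u) < 0`.
[cite: BrandenHuh2019, §2.1 Lemma 2.5 ((2)/(3) ⟹ (4)/(5)); §2.3 proof of Lemma 2.12 ("`∂^α f|_{x=c} < 0`")] -/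
theorem toBilin'_smul_sub_self_neg_of_mul_lt_sq {H : Matrix σ σ ℝ} (hH : H.IsSymm) {u v : σ → ℝ}
    (hu : 0 < Matrix.toBilin' H u u)
    (h : Matrix.toBilin' H v v * Matrix.toBilin' H u u < Matrix.toBilin' H v u ^ 2) :
    Matrix.toBilin' H ((Matrix.toBilin' H u v / Matrix.toBilin' H u u) • u - v)
      ((Matrix.toBilin' H u v / Matrix.toBilin' H u u) • u - v) < 0 := by
  rw [toBilin'_smul_sub_self hH]
  rw [symm_apply (isSymm_toBilin'_of_isSymm hH) v u] at h
  have hne : Matrix.toBilin' H u u ≠ 0 := hu.ne'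
  have key : (Matrix.toBilin' H u v / Matrix.toBilin' H u u) ^ 2 * Matrix.toBilin' H u u -
      2 * (Matrix.toBilin' H u v / Matrix.toBilin' H u u) * Matrix.toBilin' H u v + Matrix.toBilin' H v v =
      (Matrix.toBilin' H v v * Matrix.toBilin' H u u - Matrix.toBilin' H u v ^ 2) / Matrix.toBilin' H u u := by
    field_simp
    ring
  rw [key]
  exact div_neg_of_neg_of_pos (by linarith) hu

/-- The critical point is `B`-orthogonal to `u`: `B(u, (B(u,v)/B(u,u)) u - v) = 0` ("Let `c` be the unique zero of
`∂^{α+e_n} f`"). [cite: BrandenHuh2019, §2.3 proof of Lemma 2.12 (claim (I))] -/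
theorem toBilin'_self_smul_sub_eq_zero (H : Matrix σ σ ℝ) {u : σ → ℝ} (hu : Matrix.toBilin' H u u ≠ 0) (v : σ → ℝ) :
    Matrix.toBilin' H u ((Matrix.toBilin' H u v / Matrix.toBilin' H u u) • u - v) = 0 := by
  simp only [map_sub, map_smul, smul_eq_mul]
  rw [div_mul_cancel₀ _ hu, sub_self]

/-- **Lemma 2.5, (4)/(5) in Hessian form**: for a quadratic form `f` and `u` with `f(u) > 0`, the univariate `f(xu - v)`
takes a negative value (equivalently, has two distinct real zeros — its leading coefficient `f(u)` is positive) iff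
`(uᵀ𝓗_f v)² > (uᵀ𝓗_f u)(vᵀ𝓗_f v)` ("the univariate polynomial `½ f(xu - v)` has the discriminant
`(uᵀ𝓗_f v)² - (uᵀ𝓗_f u)(vᵀ𝓗_f v)`"). [cite: BrandenHuh2019, §2.1 Lemma 2.5 ((4), (5) and the last paragraph of the
proof)] -/
theorem exists_eval_smul_sub_neg_iff_mul_lt_sq {q : MvPolynomial σ ℝ} (hq : q.IsHomogeneous 2) {u : σ → ℝ}
    (hu : 0 < Matrix.toBilin' (hessian q) u u) (v : σ → ℝ) :
    (∃ x : ℝ, eval (x • u - v) q < 0) ↔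
      Matrix.toBilin' (hessian q) v v * Matrix.toBilin' (hessian q) u u < Matrix.toBilin' (hessian q) v u ^ 2 := by
  constructor
  · rintro ⟨x, hx⟩
    refine mul_lt_sq_of_toBilin'_smul_sub_self_neg (isSymm_hessian q) hu (x := x) ?_
    rw [← two_mul_eval_eq_toBilin'_hessian hq]
    linarith
  · intro h
    refine ⟨Matrix.toBilin' (hessian q) u v / Matrix.toBilin' (hessian q) u u, ?_⟩
    have h2 := toBilin'_smul_sub_self_neg_of_mul_lt_sq (isSymm_hessian q) hu h
    rw [← two_mul_eval_eq_toBilin'_hessian hq] at h2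
    linarith

/-- **Lemma 2.5, (1) ⟺ (5) (with (4)), negative-value form**: `f ∈ P²_n` is strictly Lorentzian iff, for a fixed `u`
with `f(u) > 0`, the restriction `f(xu - v)` takes a negative value for every `v` not parallel to `u`.
[cite: BrandenHuh2019, §2.1 Lemma 2.5 ((1) ⟺ (4) ⟺ (5))] -/
theorem mem_strictlyLorentzian_two_iff_forall_exists_eval_neg {q : MvPolynomial σ ℝ} (hq : q.IsHomogeneous 2)
    (hpos : ∀ α : σ →₀ ℕ, α.degree = 2 → 0 < coeff α q) {u : σ → ℝ} (hu : 0 < Matrix.toBilin' (hessian q) u u) :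
    q ∈ strictlyLorentzian σ 2 ↔ ∀ v : σ → ℝ, (∀ t : ℝ, v ≠ t • u) → ∃ x : ℝ, eval (x • u - v) q < 0 := by
  rw [mem_strictlyLorentzian_two_iff_forall_mul_lt_sq hq hpos hu]
  exact forall₂_congr fun v _ ↦ (exists_eval_smul_sub_neg_iff_mul_lt_sq hq hu v).symm

omit [Fintype σ] [DecidableEq σ] in
/-- A real quadratic `a x² + b x + c` with `a > 0` has two distinct real zeros iff it takes a negative value (the vertex
value is `-(b² - 4ac)/(4a)`; between two zeros `x ≠ y` the midpoint value is `-a (x - y)²/4`). [folklore]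
[cite: BrandenHuh2019, §2.1 Lemma 2.5 (last paragraph of the proof, the discriminant)] -/
theorem exists_ne_quadratic_eq_zero_iff_exists_neg {a b c : ℝ} (ha : 0 < a) :
    (∃ x y : ℝ, x ≠ y ∧ a * (x * x) + b * x + c = 0 ∧ a * (y * y) + b * y + c = 0) ↔
      ∃ x : ℝ, a * (x * x) + b * x + c < 0 := by
  constructor
  · rintro ⟨x, y, hxy, hx, hy⟩
    have hb : b = -a * (x + y) := by
      have h1 : (x - y) * (a * (x + y) + b) = 0 := by linear_combination hx - hy
      have h2 : a * (x + y) + b = 0 := (mul_eq_zero.1 h1).resolve_left (sub_ne_zero.2 hxy)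
      linarith
    have hc : c = a * x * y := by rw [hb] at hx; linear_combination hx
    refine ⟨(x + y) / 2, ?_⟩
    rw [hb, hc]
    have hsq : 0 < (x - y) ^ 2 := by positivity
    nlinarith
  · rintro ⟨x, hx⟩
    have hdisc : 0 < discrim a b c := by
      rw [discrim]; nlinarith [sq_nonneg (2 * a * x + b)]
    set s := Real.sqrt (discrim a b c) with hs
    have hs0 : 0 < s := Real.sqrt_pos.2 hdisc
    have hss : discrim a b c = s * s := (Real.mul_self_sqrt hdisc.le).symm
    refine ⟨(-b + s) / (2 * a), (-b - s) / (2 * a), ?_, ?_, ?_⟩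
    · intro h
      have h2 : -b + s = -b - s := by
        have := congrArg (· * (2 * a)) h
        simpa [div_mul_cancel₀, ha.ne'] using this
      linarith
    · exact (quadratic_eq_zero_iff ha.ne' hss _).2 (Or.inl rfl)
    · exact (quadratic_eq_zero_iff ha.ne' hss _).2 (Or.inr rfl)

/-- **"`f(xu - v)` has two distinct real zeros" iff it takes a negative value** (`f(u) > 0` is the leading coefficient of
`x ↦ f(xu - v) = f(u) x² - (uᵀ𝓗v) x + f(v)`). [cite: BrandenHuh2019, §2.1 Lemma 2.5 ((4), (5) and the last paragraph of
the proof)] -/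
theorem exists_ne_eval_smul_sub_eq_zero_iff {q : MvPolynomial σ ℝ} (hq : q.IsHomogeneous 2) {u : σ → ℝ}
    (hu : 0 < Matrix.toBilin' (hessian q) u u) (v : σ → ℝ) :
    (∃ x y : ℝ, x ≠ y ∧ eval (x • u - v) q = 0 ∧ eval (y • u - v) q = 0) ↔ ∃ x : ℝ, eval (x • u - v) q < 0 := by
  have ha : 0 < eval u q := by
    have h := two_mul_eval_eq_toBilin'_hessian hq u
    linarith
  simp only [eval_smul_sub_eq hq]
  exact exists_ne_quadratic_eq_zero_iff_exists_neg ha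

/-- **Lemma 2.5, (1) ⟺ (5) as printed: `f ∈ L̊²_n` iff "for some `u` [with `f(u) > 0`], the univariate polynomial
`f(xu - v)` in `x` has two distinct real zeros for any `v ∈ ℝ^n` not parallel to `u`"** (and then for any such `u`,
(4)). [cite: BrandenHuh2019, §2.1 Lemma 2.5 ((1) ⟺ (4) ⟺ (5))] -/
theorem mem_strictlyLorentzian_two_iff_forall_exists_ne_eval_eq_zero {q : MvPolynomial σ ℝ} (hq : q.IsHomogeneous 2)
    (hpos : ∀ α : σ →₀ ℕ, α.degree = 2 → 0 < coeff α q) {u : σ → ℝ} (hu : 0 < Matrix.toBilin' (hessian q) u u) :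
    q ∈ strictlyLorentzian σ 2 ↔ ∀ v : σ → ℝ, (∀ t : ℝ, v ≠ t • u) →
      ∃ x y : ℝ, x ≠ y ∧ eval (x • u - v) q = 0 ∧ eval (y • u - v) q = 0 := by
  rw [mem_strictlyLorentzian_two_iff_forall_exists_eval_neg hq hpos hu]
  exact forall₂_congr fun v _ ↦ (exists_ne_eval_smul_sub_eq_zero_iff hq hu v).symm

end Lemma25

/-! ## §4 The second description of `L̊^d_n` -/

section SecondDescription

/-- **`f ∈ L̊^{d+1}_n ⇒ ∂_i f ∈ L̊^d_n`** in every degree (by definition for `d + 1 ≥ 3`; for `d + 1 ≤ 2` the target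
conditions are homogeneity and positivity of the coefficients). [cite: BrandenHuh2019, §2.1 Def. 2.1 (p. 8)] -/
theorem pderiv_mem_strictlyLorentzian_of_succ :
    ∀ {d : ℕ} {f : MvPolynomial σ ℝ}, f ∈ strictlyLorentzian σ (d + 1) → ∀ i : σ,
      pderiv i f ∈ strictlyLorentzian σ d
  | 0, _, h, i => ⟨h.1.pderiv, fun β hβ ↦ coeff_pderiv_pos_of_forall_coeff_pos h.2 i β hβ⟩
  | 1, _, h, i => ⟨h.1.pderiv, fun β hβ ↦ coeff_pderiv_pos_of_forall_coeff_pos h.2.1 i β hβ⟩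
  | _ + 2, _, h, i => h.2.2 i

/-- **`f ∈ L̊^{d+|α|}_n ⇒ ∂^α f ∈ L̊^d_n`.** [cite: BrandenHuh2019, §2.1 Def. 2.1 ("`L̊^d_n = {f ∈ P^d_n | ∂^α f ∈ L̊²_n
for every α ∈ Δ^{d-2}_n}`")] -/
theorem iterPderiv_mem_strictlyLorentzian {d : ℕ} :
    ∀ {α : σ →₀ ℕ} {f : MvPolynomial σ ℝ}, f ∈ strictlyLorentzian σ (d + α.degree) →
      iterPderiv α f ∈ strictlyLorentzian σ d := by
  suffices h : ∀ (n : ℕ) {α : σ →₀ ℕ} {f : MvPolynomial σ ℝ}, α.degree = n → f ∈ strictlyLorentzian σ (d + n) →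
      iterPderiv α f ∈ strictlyLorentzian σ d from fun {α} {f} hf ↦ h _ rfl hf
  intro n
  induction n with
  | zero =>
    intro α f hα hf
    rw [Finsupp.degree_eq_zero_iff] at hα
    subst hα
    rwa [iterPderiv_zero]
  | succ n ih =>
    intro α f hα hf
    have hα0 : α ≠ 0 := by
      intro h0; rw [h0, map_zero] at hα; exact Nat.succ_ne_zero n hα.symm
    obtain ⟨i, hi⟩ := Finsupp.ne_iff.1 hα0
    have hαi : α i ≠ 0 := by simpa using hi
    have hdeg : (α - Finsupp.single i 1).degree = n := by
      have := degree_sub_single_add_one hαi; omega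
    rw [← sub_add_single_one_cancel hαi, iterPderiv_add_single']
    exact ih hdeg (pderiv_mem_strictlyLorentzian_of_succ (by rwa [← add_assoc] at hf) i)

/-- **The second description of `L̊^d_n` (Definition 2.1): `L̊^d_n = {f ∈ P^d_n | ∂^α f ∈ L̊²_n for every
α ∈ Δ^{d-2}_n}`** (`d = m + 2`). [cite: BrandenHuh2019, §2.1 Def. 2.1 (p. 8, "Thus `L̊^d_n = …`")] -/
theorem mem_strictlyLorentzian_iff_forall_iterPderiv {m : ℕ} {f : MvPolynomial σ ℝ} :
    f ∈ strictlyLorentzian σ (m + 2) ↔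
      (f.IsHomogeneous (m + 2) ∧ ∀ α : σ →₀ ℕ, α.degree = m + 2 → 0 < coeff α f) ∧
        ∀ α : σ →₀ ℕ, α.degree = m → iterPderiv α f ∈ strictlyLorentzian σ 2 := by
  constructor
  · intro hf
    refine ⟨⟨isHomogeneous_of_mem_strictlyLorentzian hf, coeff_pos_of_mem_strictlyLorentzian hf⟩,
      fun α hα ↦ iterPderiv_mem_strictlyLorentzian ?_⟩
    rwa [hα, add_comm]
  · induction m generalizing f with
    | zero =>
      rintro ⟨-, h⟩
      simpa only [iterPderiv_zero] using h 0 (map_zero _)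
    | succ m ih =>
      rintro ⟨⟨hhom, hpos⟩, h⟩
      refine ⟨hhom, hpos, fun i ↦ ih ⟨⟨hhom.pderiv, fun β hβ ↦
        coeff_pderiv_pos_of_forall_coeff_pos hpos i β hβ⟩, fun α hα ↦ ?_⟩⟩
      rw [← iterPderiv_add_single']
      exact h _ (by rw [map_add, Finsupp.degree_single, hα])

/-- `L̊²`-membership of `∂^α f` read on the matrix `(c_{α+e_a+e_b}(f))_{a,b} = 𝓗(∂^α f)`.
[cite: BrandenHuh2019, §2.1 Def. 2.1; §2.2 (p. 11, normalized coefficients)] -/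
theorem iterPderiv_mem_strictlyLorentzian_two_iff {m : ℕ} {f : MvPolynomial σ ℝ} (hf : f.IsHomogeneous (m + 2))
    {α : σ →₀ ℕ} (hα : α.degree = m) :
    iterPderiv α f ∈ strictlyLorentzian σ 2 ↔
      (∀ β : σ →₀ ℕ, β.degree = 2 → 0 < coeff (α + β) f) ∧
        (Matrix.of fun a b ↦ normCoeff (α + Finsupp.single a 1 + Finsupp.single b 1) f).det ≠ 0 ∧
        sigPos (Matrix.toBilin'
          (Matrix.of fun a b ↦ normCoeff (α + Finsupp.single a 1 + Finsupp.single b 1) f)).toQuadraticMap = 1 := by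
  rw [mem_strictlyLorentzian_two, ← hessian_iterPderiv_eq]
  have hhom : (iterPderiv α f).IsHomogeneous 2 := IsHomogeneous.iterPderiv α (by rw [hα, add_comm]; exact hf)
  have hcoeff : ∀ β : σ →₀ ℕ, 0 < coeff β (iterPderiv α f) ↔ 0 < coeff (α + β) f := fun β ↦ by
    rw [← normCoeff_pos_iff, normCoeff_iterPderiv, normCoeff_pos_iff]
  simp only [hcoeff]
  exact ⟨fun ⟨_, h2, h3, h4⟩ ↦ ⟨h2, h3, h4⟩, fun ⟨h2, h3, h4⟩ ↦ ⟨hhom, h2, h3, h4⟩⟩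

end SecondDescription

end Literature.Combinatorics.LorentzianPolynomials

end
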